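import Literature.AnabelianGeometry.SemiGraphs.OverStarSectionRigidity
import Literature.AnabelianGeometry.SemiGraphs.PullbackFunctorExact
import Literature.AnabelianGeometry.SemiGraphs.DecompositionGroupGeneral
import Mathlib.CategoryTheory.Limits.Preserves.Shapes.Terminal

/-!
# The EDGE section map of the local↔global comparison sends the edge base point to the global one
# ([SemiAnbd] Def. 2.2 (i) p. 23, Rem. 2.2.1 p. 24)

Mochizuki, *Semi-graphs of anabelioids*, Publ. RIMS **42** (2006) 221–322, §2: Def. 2.2 (i) p. 23 (the
covering `ℋ → 𝒦` attached to `A ∈ B(𝒦)`: GLOBALLY `B(ℋ) = B(𝒦)_{/A}`; LOCALLY, at an EDGE `e′ ↦ f`,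
`ℋ_{e′} = (𝒦_f)_Q` for a connected component `Q` of `A_f`) and Rem. 2.2.1 p. 24
[cite: MochizukiSemiAnbd2006, Def. 2.2(i) p.23].

PROOF-ONLY companion (abc-iut cell, layer L3; FACT-LIST row F-1478 `remark_2_4_1_covering`, residual
(L)/(J1), sub-brick (L-σ) at EDGES = (E-σ) «categorical half»; seat abc-iut-w4-d079).  abc-iut-w5-d041's
vertex comparison (`FiniteEtaleCoveringLocalGlobalSection`: `K_w = αψ ⋙ ρ_w ⋙ α_w⁻¹`, section map
`σ_w`) has the evident EDGE analogue `K_{e′} := αψ ⋙ ρ_{e′} ⋙ α_{e′}⁻¹ : B(𝒦)_{/A} ⥤ (𝒦_f)_{/Q}` for a local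
edge witness `α_{e′} : (𝒦_f)_{/Q} ⥲ ℋ_{e′}`, `e_{e′} : ψ_{e′}^* ≅ (Q × −) ⋙ α_{e′}` (image edge presented as
`p : ψ e′ = f`, `Hom.φE e′ f p`; re-indexing `Hom.reindexIso`).  No definition is introduced here: the
comparison functor, its identification `ι : (A × −) ⋙ K_{e′} ≅ ρ_f ⋙ (Q × −)` and its section map are
written out as `OverStar.sectionMap` of explicit expressions, and the main theorem is stated for ANY
identification `ι` satisfying the one equation (`hι`) that the evident one satisfies
(`map_localGlobalIsoE_hom_app_comp`):

* `Hom.map_localGlobalIsoE_hom_app_comp` — the evident `ι_{e′}` (from `e_ψ`, `reindexIso`, `e_{e′}` and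
  the unit of `α_{e′}`) satisfies `α_{e′}(ι_A) ≫ e_{e′}⁻¹_{A_f} = ε ≫ (e_ψ⁻¹_A)_{e′} ≫ reindex`;
* `Hom.map_sectionMapE_basePoint` — **`F(σ_{e′})` sends the LOCAL edge base point `q₀` (the point of
  `range_pi1Map_eq_stabilizer′` for `α_{e′}, e_{e′}`) to the GLOBAL base point read at the edge basepoint
  `ρ_{e′} ⋙ F_{e′}`** (the point of `range_pi1Map_eq_stabilizer′` for `αψ, e_ψ` and that basepoint) —
  for any `ι` with `hι`, by naturality and the one-point fibres of the terminal objects;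
* `Hom.map_sectionMapE_basePoint_std` — the same for the evident `ι_{e′}`.

The GROUP half at edges is abc-iut-f-161's `EdgeAlignedStabilizers.lean` (`IsBranchAligned.edge_mono_of_map_eq`,
whose transported point is compared with the one here in a sequel).  Nothing here takes a side on
[IUTchIII] Cor. 3.12.
-/

namespace Literature.AnabelianGeometry.SemiGraphs

namespace SemiGraphOfAnabelioids

namespace Hom

open CategoryTheory CategoryTheory.Limits CategoryTheory.PreGaloisCategory
open Literature.AnabelianGeometry.Anabelioids

universe v₁ u₁ u

variable {ℋ 𝒦 : SemiGraphOfAnabelioids.{v₁, u₁, u}} (ψ : Hom ℋ 𝒦) (A : 𝒦.BObj)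
  [HasBinaryProducts 𝒦.BObj] (αψ : Over A ⥤ ℋ.BObj) [αψ.IsEquivalence]
  (eψ : ψ.pullbackFunctor ≅ Over.star A ⋙ αψ) (e' : ℋ.graph.Edge) (f : 𝒦.graph.Edge)
  (p : ψ.base.edgeMap e' = f) (Q : 𝒦.E f) (αE : Over Q ⥤ ℋ.E e') [αE.IsEquivalence]
  (eEloc : (ψ.φE e' f p).pullback ≅ Over.star Q ⋙ αE)

/-! ### The edge comparison functor `K_{e′} = αψ ⋙ ρ_{e′} ⋙ α_{e′}⁻¹` (written out, no definition) -/

omit [HasBinaryProducts 𝒦.BObj] in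
/-- `K_{e′}` preserves equalizers (equivalences do; `ρ_{e′}` does, limits in `B(ℋ)` being componentwise).
[cite: MochizukiSemiAnbd2006, Def. 2.2(i) p.23] -/
theorem localGlobalFunctorE_preservesEqualizers :
    PreservesLimitsOfShape WalkingParallelPair (αψ ⋙ ℋ.ρE e' ⋙ αE.inv) := by
  obtain ⟨-, -, hρE⟩ := ℋ.hasLimitsOfShape_bObj (J := WalkingParallelPair)
  haveI := hρE e'
  infer_instance

omit [HasBinaryProducts 𝒦.BObj] in
/-- `K_{e′}(𝟙_A)` is terminal. [cite: MochizukiSemiAnbd2006, Def. 2.2(i) p.23] -/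
theorem localGlobalFunctorE_isTerminal :
    Nonempty (IsTerminal ((αψ ⋙ ℋ.ρE e' ⋙ αE.inv).obj (Over.mk (𝟙 A)))) := by
  obtain ⟨-, -, hρE⟩ := ℋ.hasLimitsOfShape_bObj (J := Discrete PEmpty.{1})
  haveI := hρE e'
  haveI : PreservesLimitsOfShape (Discrete PEmpty.{1}) (αψ ⋙ ℋ.ρE e' ⋙ αE.inv) := inferInstance
  exact ⟨Over.mkIdTerminal.isTerminalObj (αψ ⋙ ℋ.ρE e' ⋙ αE.inv) (Over.mk (𝟙 A))⟩

/-! ### Bookkeeping for the adjoint equivalence `α_{e′}` -/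

omit [HasBinaryProducts 𝒦.BObj] in
/-- The triangle identity `ε⁻¹_{α Z} ≫ α(η⁻¹_Z) = 𝟙` of the adjoint equivalence `α_{e′}`, re-associated.
[cite: MochizukiSemiAnbd2006, Def. 2.2(i) p.23] -/
theorem counitInv_app_comp_map_unitInv_compE (Z : Over Q) {X : ℋ.E e'} (g : αE.obj Z ⟶ X) :
    αE.asEquivalence.counitIso.inv.app (αE.obj Z) ≫
        αE.map (αE.asEquivalence.unitIso.inv.app Z) ≫ g = g := by
  rw [← Category.assoc]
  exact (congrArg (· ≫ g) (αE.asEquivalence.counitInv_functor_comp Z)).trans (Category.id_comp g)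

omit [HasBinaryProducts 𝒦.BObj] in
/-- At the canonical presentation the re-indexing isomorphism is the identity.
[cite: MochizukiSemiAnbd2006, Rem. 2.4.2 p.26] -/
theorem reindexIso_rfl_eq :
    ψ.reindexIso e' (ψ.base.edgeMap e') (ψ.base.edgeMap e') rfl rfl = Iso.refl _ := rfl

/-! ### The evident identification `ι_{e′}` and its key equation -/

omit [αψ.IsEquivalence] in
set_option backward.isDefEq.respectTransparency false in
/-- **The evident identification read through `α_{e′}` and `e_{e′}`.**  For
`ι_{e′} := (e_ψ⁻¹ ▷ (ρ_{e′} ⋙ α⁻¹)) ≪≫ (reindex ▷ α⁻¹) ≪≫ (ρ_f ◁ (e_{e′} ▷ α⁻¹)) ≪≫ (… ◁ η⁻¹)`: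
`α(ι_A) ≫ e_{e′}⁻¹_{A_f} = ε ≫ (e_ψ⁻¹_A)_{e′} ≫ reindex_A` (triangle identity of `α_{e′}`,
`e_{e′} e_{e′}⁻¹ = 1`). [cite: MochizukiSemiAnbd2006, Def. 2.2(i) p.23] -/
theorem map_localGlobalIsoE_hom_app_comp :
    αE.map ((Functor.isoWhiskerRight eψ.symm (ℋ.ρE e' ⋙ αE.inv) ≪≫
        Functor.isoWhiskerRight (ψ.reindexIso e' (ψ.base.edgeMap e') f rfl p) αE.inv ≪≫
        Functor.isoWhiskerLeft (𝒦.ρE f) (Functor.isoWhiskerRight eEloc αE.inv) ≪≫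
        Functor.isoWhiskerLeft (𝒦.ρE f ⋙ Over.star Q) αE.asEquivalence.unitIso.symm :
          Over.star A ⋙ (αψ ⋙ ℋ.ρE e' ⋙ αE.inv) ≅ 𝒦.ρE f ⋙ Over.star Q).hom.app A) ≫
        eEloc.inv.app (A.T f) =
      αE.asEquivalence.counitIso.hom.app ((αψ.obj ((Over.star A).obj A)).T e') ≫
        (eψ.inv.app A).fT e' ≫ (ψ.reindexIso e' (ψ.base.edgeMap e') f rfl p).hom.app A := by
  subst p
  simp only [reindexIso_rfl_eq, Iso.trans_hom, NatTrans.comp_app, Functor.isoWhiskerRight_hom,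
    Functor.isoWhiskerLeft_hom, Functor.whiskerRight_app, Functor.whiskerLeft_app, Iso.symm_hom,
    Iso.refl_hom, NatTrans.id_app, Functor.comp_map, CategoryTheory.Functor.map_comp, Category.assoc]
  simp only [Functor.fun_inv_map, Category.assoc]
  erw [Category.id_comp]
  erw [Equivalence.counitIso_inv_hom_id_app_assoc]
  erw [Equivalence.counitIso_inv_hom_id_app_assoc]
  erw [counitInv_app_comp_map_unitInv_compE]
  erw [Iso.hom_inv_id_app]
  erw [Category.comp_id]
  rfl

/-! ### The section of `K_{e′}` and the base points, for ANY identification `ι` satisfying `hι` -/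

/-- The diagonal at `𝟙_A` is the unit at `𝟙_A` (the graph of `𝟙_A`).
[cite: MochizukiSemiAnbd2006, Def. 2.2(i) p.23] -/
private theorem diagTop_eq_unitE :
    OverStar.diagTop (Over.forgetAdjStar A) = (Over.forgetAdjStar A).unit.app (Over.mk (𝟙 A)) := by
  rw [OverStar.diagTop, OverStar.unit'_eq]
  have h : (Over.star A).map (Over.mk (𝟙 A)).hom = 𝟙 _ := CategoryTheory.Functor.map_id _ _
  rw [h]
  exact Category.comp_id _

omit [αψ.IsEquivalence] in
set_option backward.isDefEq.respectTransparency false in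
/-- **`α_{e′}` of the section of `K_{e′}`**, for any identification `ι : (A × −) ⋙ K_{e′} ≅ ρ_f ⋙ (Q × −)`
with `α(ι_A) ≫ e_{e′}⁻¹_{A_f} = ε ≫ (e_ψ⁻¹_A)_{e′} ≫ reindex_A`:
`α(section) ≫ e_{e′}⁻¹_{A_f} = θ ≫ (αψ(diag) ≫ e_ψ⁻¹_A)_{e′} ≫ reindex_A`, `θ := α(!) ≫ ε`.
[cite: MochizukiSemiAnbd2006, Rem. 2.2.1 p.24] -/
theorem map_section_compE
    (ι : Over.star A ⋙ (αψ ⋙ ℋ.ρE e' ⋙ αE.inv) ≅ 𝒦.ρE f ⋙ Over.star Q)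
    (hT : IsTerminal ((αψ ⋙ ℋ.ρE e' ⋙ αE.inv).obj (Over.mk (𝟙 A))))
    (hι : αE.map (ι.hom.app A) ≫ eEloc.inv.app (A.T f) =
      αE.asEquivalence.counitIso.hom.app ((αψ.obj ((Over.star A).obj A)).T e') ≫
        (eψ.inv.app A).fT e' ≫ (ψ.reindexIso e' (ψ.base.edgeMap e') f rfl p).hom.app A) :
    αE.map (OverStar.section_ (Over.forgetAdjStar A) (αψ ⋙ ℋ.ρE e' ⋙ αE.inv) (𝒦.ρE f) ι hT) ≫
      eEloc.inv.app (A.T f) =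
    (αE.map (hT.from (Over.mk (𝟙 Q))) ≫
        αE.asEquivalence.counitIso.hom.app ((αψ.obj (Over.mk (𝟙 A))).T e')) ≫
      (αψ.map (OverStar.diagTop (Over.forgetAdjStar A)) ≫ eψ.inv.app A).fT e' ≫
        (ψ.reindexIso e' (ψ.base.edgeMap e') f rfl p).hom.app A := by
  rw [OverStar.section_, CategoryTheory.Functor.map_comp, CategoryTheory.Functor.map_comp,
    Category.assoc, Category.assoc, OverStar.ιHom_eq]
  erw [hι]
  have hK : (αψ ⋙ ℋ.ρE e' ⋙ αE.inv).map (OverStar.diagTop (Over.forgetAdjStar A)) =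
      αE.inv.map ((αψ.map (OverStar.diagTop (Over.forgetAdjStar A))).fT e') := rfl
  rw [hK, Functor.fun_inv_map]
  simp only [Category.assoc, BObj.comp_fT]
  erw [Equivalence.counitIso_inv_hom_id_app_assoc]

omit [αψ.IsEquivalence] in
set_option backward.isDefEq.respectTransparency false in
/-- **The edge section map sends the local edge base point to the global one** ([SemiAnbd] Rem. 2.2.1:
the edge `e′` IS a component of `A_f`, placed by the global equivalence).  For ANY identification `ι`
with `hι`, basepoints `F_{e′}` of `ℋ_{e′}`, `F` of `𝒦_f`, `e_E : ψ_{e′}^* ⋙ F_{e′} ≅ F`, and the one-point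
fibres `t` of `F_{e′}((αψ 𝟙_A)_{e′})`, `t′` of `F_{e′}(α 𝟙_Q)`: `F(σ_{e′})` carries the LOCAL base point
`e_E(F_{e′}(α(η_{𝟙_Q}) ≫ e_{e′}⁻¹_Q)(t′))` (the point of `range_pi1Map_eq_stabilizer′` for `α_{e′}, e_{e′}`)
to the GLOBAL base point `(reindex ▷ F_{e′} ≪≫ ρ_f ◁ e_E)((ρ_{e′} ⋙ F_{e′})(αψ(η_{𝟙_A}) ≫ e_ψ⁻¹_A)(t))`
(the point of `range_pi1Map_eq_stabilizer′` for `αψ, e_ψ` and the edge basepoint `ρ_{e′} ⋙ F_{e′}`).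
[cite: MochizukiSemiAnbd2006, Rem. 2.2.1 p.24] -/
theorem map_sectionMapE_basePoint
    (ι : Over.star A ⋙ (αψ ⋙ ℋ.ρE e' ⋙ αE.inv) ≅ 𝒦.ρE f ⋙ Over.star Q)
    (hT : IsTerminal ((αψ ⋙ ℋ.ρE e' ⋙ αE.inv).obj (Over.mk (𝟙 A))))
    (hι : αE.map (ι.hom.app A) ≫ eEloc.inv.app (A.T f) =
      αE.asEquivalence.counitIso.hom.app ((αψ.obj ((Over.star A).obj A)).T e') ≫
        (eψ.inv.app A).fT e' ≫ (ψ.reindexIso e' (ψ.base.edgeMap e') f rfl p).hom.app A)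
    (Fe' : ℋ.E e' ⥤ FintypeCat.{v₁}) (F : 𝒦.E f ⥤ FintypeCat.{v₁})
    (eE : (ψ.φE e' f p).pullback ⋙ Fe' ≅ F)
    [Subsingleton (Fe'.obj ((αψ.obj (Over.mk (𝟙 A))).T e'))]
    (t : (ℋ.ρE e' ⋙ Fe').obj (αψ.obj (Over.mk (𝟙 A)))) (t' : Fe'.obj (αE.obj (Over.mk (𝟙 Q)))) :
    F.map (OverStar.sectionMap (Over.forgetAdjStar A) (Over.forgetAdjStar Q)
        (αψ ⋙ ℋ.ρE e' ⋙ αE.inv) (𝒦.ρE f) ι hT)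
        (eE.hom.app Q (Fe'.map (αE.map ((Over.forgetAdjStar Q).unit.app (Over.mk (𝟙 Q))) ≫
          eEloc.inv.app Q) t')) =
      (show F.obj (A.T f) from
        (Functor.isoWhiskerRight (ψ.reindexIso e' (ψ.base.edgeMap e') f rfl p) Fe' ≪≫
            Functor.isoWhiskerLeft (𝒦.ρE f) eE).hom.app A
          ((ℋ.ρE e' ⋙ Fe').map (αψ.map ((Over.forgetAdjStar A).unit.app (Over.mk (𝟙 A))) ≫
            eψ.inv.app A) t)) := by
  set σE := OverStar.sectionMap (Over.forgetAdjStar A) (Over.forgetAdjStar Q)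
    (αψ ⋙ ℋ.ρE e' ⋙ αE.inv) (𝒦.ρE f) ι hT with hσE
  -- (1) naturality of `e_E` moves everything into `F_{e′}`
  have h1 := FunctorToFintypeCat.naturality ((ψ.φE e' f p).pullback ⋙ Fe') F eE.hom σE
    (Fe'.map (αE.map ((Over.forgetAdjStar Q).unit.app (Over.mk (𝟙 Q))) ≫ eEloc.inv.app Q) t')
  refine h1.symm.trans ?_
  change eE.hom.app (A.T f)
      (Fe'.map ((ψ.φE e' f p).pullback.map σE)
        (Fe'.map (αE.map ((Over.forgetAdjStar Q).unit.app (Over.mk (𝟙 Q))) ≫ eEloc.inv.app Q) t')) =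
    eE.hom.app (A.T f)
      (Fe'.map ((ψ.reindexIso e' (ψ.base.edgeMap e') f rfl p).hom.app A)
        (Fe'.map ((αψ.map ((Over.forgetAdjStar A).unit.app (Over.mk (𝟙 A))) ≫ eψ.inv.app A).fT e')
          t))
  congr 1
  -- (2) `α(η_{𝟙_Q}) ≫ e_{e′}⁻¹_Q ≫ ψ_{e′}^*(σ) = α(section) ≫ e_{e′}⁻¹_{A_f}`
  have h2 : (αE.map ((Over.forgetAdjStar Q).unit.app (Over.mk (𝟙 Q))) ≫ eEloc.inv.app Q) ≫
      (ψ.φE e' f p).pullback.map σE =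
      αE.map (OverStar.section_ (Over.forgetAdjStar A) (αψ ⋙ ℋ.ρE e' ⋙ αE.inv) (𝒦.ρE f) ι hT) ≫
        eEloc.inv.app (A.T f) := by
    rw [Category.assoc]
    erw [← eEloc.inv.naturality σE]
    rw [← Category.assoc]
    erw [← αE.map_comp]
    congr 2
    rw [hσE, OverStar.sectionMap, ← OverStar.unit'_eq]
    exact (OverStar.eq_unit_comp_map_tr (Over.forgetAdjStar Q) _).symm
  have h3 : Fe'.map ((ψ.φE e' f p).pullback.map σE)
      (Fe'.map (αE.map ((Over.forgetAdjStar Q).unit.app (Over.mk (𝟙 Q))) ≫ eEloc.inv.app Q) t') =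
      Fe'.map ((αE.map ((Over.forgetAdjStar Q).unit.app (Over.mk (𝟙 Q))) ≫ eEloc.inv.app Q) ≫
        (ψ.φE e' f p).pullback.map σE) t' := by
    simp only [CategoryTheory.Functor.map_comp, FintypeCat.comp_apply]
  rw [h3, h2, map_section_compE ψ A αψ eψ e' f p Q αE eEloc ι hT hι, diagTop_eq_unitE]
  -- (3) the comparison of terminal objects carries `t′` to `t`
  erw [Fe'.map_comp, FintypeCat.comp_apply]
  erw [Fe'.map_comp, FintypeCat.comp_apply]
  congr 2
  exact Subsingleton.elim (α := Fe'.obj ((αψ.obj (Over.mk (𝟙 A))).T e')) _ _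

omit [αψ.IsEquivalence] in
/-- **The edge section map of the EVIDENT identification sends the local edge base point to the global
one** (`map_sectionMapE_basePoint` with `hι := map_localGlobalIsoE_hom_app_comp`).
[cite: MochizukiSemiAnbd2006, Rem. 2.2.1 p.24] -/
theorem map_sectionMapE_basePoint_std
    (hT : IsTerminal ((αψ ⋙ ℋ.ρE e' ⋙ αE.inv).obj (Over.mk (𝟙 A))))
    (Fe' : ℋ.E e' ⥤ FintypeCat.{v₁}) (F : 𝒦.E f ⥤ FintypeCat.{v₁})
    (eE : (ψ.φE e' f p).pullback ⋙ Fe' ≅ F)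
    [Subsingleton (Fe'.obj ((αψ.obj (Over.mk (𝟙 A))).T e'))]
    (t : (ℋ.ρE e' ⋙ Fe').obj (αψ.obj (Over.mk (𝟙 A)))) (t' : Fe'.obj (αE.obj (Over.mk (𝟙 Q)))) :
    F.map (OverStar.sectionMap (Over.forgetAdjStar A) (Over.forgetAdjStar Q)
        (αψ ⋙ ℋ.ρE e' ⋙ αE.inv) (𝒦.ρE f)
        (Functor.isoWhiskerRight eψ.symm (ℋ.ρE e' ⋙ αE.inv) ≪≫
          Functor.isoWhiskerRight (ψ.reindexIso e' (ψ.base.edgeMap e') f rfl p) αE.inv ≪≫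
          Functor.isoWhiskerLeft (𝒦.ρE f) (Functor.isoWhiskerRight eEloc αE.inv) ≪≫
          Functor.isoWhiskerLeft (𝒦.ρE f ⋙ Over.star Q) αE.asEquivalence.unitIso.symm :
            Over.star A ⋙ (αψ ⋙ ℋ.ρE e' ⋙ αE.inv) ≅ 𝒦.ρE f ⋙ Over.star Q) hT)
        (eE.hom.app Q (Fe'.map (αE.map ((Over.forgetAdjStar Q).unit.app (Over.mk (𝟙 Q))) ≫
          eEloc.inv.app Q) t')) =
      (show F.obj (A.T f) from
        (Functor.isoWhiskerRight (ψ.reindexIso e' (ψ.base.edgeMap e') f rfl p) Fe' ≪≫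
            Functor.isoWhiskerLeft (𝒦.ρE f) eE).hom.app A
          ((ℋ.ρE e' ⋙ Fe').map (αψ.map ((Over.forgetAdjStar A).unit.app (Over.mk (𝟙 A))) ≫
            eψ.inv.app A) t)) :=
  map_sectionMapE_basePoint ψ A αψ eψ e' f p Q αE eEloc _ hT
    (map_localGlobalIsoE_hom_app_comp ψ A αψ eψ e' f p Q αE eEloc) Fe' F eE t t'

end Hom

end SemiGraphOfAnabelioids

end Literature.AnabelianGeometry.SemiGraphs
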